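/-
Copyright (c) 2026 the pub-hodgecm-mathlib formalisation cell (harness21).  Planner seat hodgecm-mathlib-K2E3-typ2 (g0) (typist; generator `nr1/twin.py` by K2E3-p25 (g3), L4 architect), HCML Track B «K2-LIT» ∕ h413
(`stmt-HodgeConjecture-24833`).  NR-1′ «LeThree SWEEP» (director s1979∕s1980): the hHC∕hHCB-binding theorems of ★ `K2E3KazhdanL2OrthonormalNotWild` RE-READ under the NARROWED letters
hHC₃ `characterLocallyIntegrableLeThree` ∕ hHCB₃ `normalizedCharacter_locallyBoundedLeThree` (`2 ≤ N ≤ 3`, `v` non-split) — SAME NAMES, namespace `…K2E3KazhdanL2OrthonormalNotWildLeThree`.  2026-09-04.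
-/
import Summits.HodgeConjecture.HodgeConjecture.Theorems.K2E3KazhdanL2OrthonormalCrossExtSplit   -- FILE A (this seat, p855016): `crossExtension_splits_of_isSquareIntegrable` (the `hsplit₂` letter at `L²` pairs); brings ★ (S5) `hsplit_of_isSquareIntegrable`
import Summits.HodgeConjecture.HodgeConjecture.Theorems.F0P3cStCharTSEPNormOneOfHsplit         -- ★ 73 §NW `innerG_char_self_eq_one_of_hsplit_of_not_wild` (EP-norm-one for ANY irreducible whose smooth self-extensions split, NOT-WILD `v`)
import Summits.HodgeConjecture.HodgeConjecture.Theorems.F0P3cStCharTSEPCrossNormZeroNotWild    -- ★ (X0′-NW) `innerG_char_cross_eq_zero_of_not_wild` (EP-cross-zero from `hsplit₂` + `hHom0`, NOT-WILD `v`)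
import Literature.NumberTheory.Automorphic.IrrClassSchurHomZero                                  -- ★ HOM-ZERO `SmoothIrrep.subsingleton_intertwiningMap_of_mk_ne_mk`
import Summits.HodgeConjecture.HodgeConjecture.Theorems.F0P3cStCharTSWeylDatumPinsWIF           -- ★ WIF-AT-THE-DATUM by pins: `weylIntegrationFormula_of_datumPins`
import Summits.HodgeConjecture.HodgeConjecture.Theorems.F0P3cStCharTSJacCartanTerminus          -- ★ JAC-ELL C8 terminus: `tubeJacobianSocket_compactCartan`
import Summits.HodgeConjecture.HodgeConjecture.Theorems.F0P3cStCharTSCartanReps                 -- ★ `exists_isRegularElt_centralizer_eq_cmTorus` (`M = Z(m₀)`)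
import Summits.HodgeConjecture.HodgeConjecture.Theorems.F0P3cStCharTSCartanFields               -- ★ (C2) `ellCartanAE_of_compact_centralizers`, (C3) `nonEllCartanAE_of_split`
import Summits.HodgeConjecture.HodgeConjecture.Theorems.F0P3cStCharTSCartanNull                 -- ★ `cartanNull_of_rootKernels`
import Summits.HodgeConjecture.HodgeConjecture.Theorems.F0P3cStCharTSDGField                    -- ★ `measurable_DG`, `DG_eq_zero_or_le` (from the closed formula `eDG`)
import Summits.HodgeConjecture.HodgeConjecture.Theorems.F0P3cStCharTSL2dOfHcb                   -- ★ `l2CharOnTorusAll_of_hcBounded` ((L2D∀) from `normalizedCharacter_locallyBounded`)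
import HarnessLib
import Summits.HodgeConjecture.HodgeConjecture.Theorems.K2E3KazhdanL2OrthonormalNotWild   -- ★ the original: every non-letter lemma REUSED by qualified name
import Summits.HodgeConjecture.HodgeConjecture.Theorems.K2E3CharLettersLeThreeDefs   -- NR-1′ root: hHC₃ ∕ hHCB₃
import Summits.HodgeConjecture.HodgeConjecture.Theorems.K2E3L2dOfHcbLeThree   -- NR-1′ twin of ★ L2dOfHcb (`l2CharOnTorusAll_of_hcBounded` under hHCB₃, + `hns`)

/-!
# NR-1′ twin — ★ `K2E3KazhdanL2OrthonormalNotWild` under the narrowed Harish-Chandra letters (`2 ≤ N ≤ 3`, `v` non-split)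

Cell `pub/hodgecm-mathlib`, crux H413 = `stmt-HodgeConjecture-24833`, line L4 `stub_StCharTS`; director rulings NR-1′ (s1979) ∕ «GO — LeThree SWEEP» (s1980); architect memo
`K2/K2E3-p25/g3/NR1-narrowing-cone.K2E3-p25-g3.md`.  THEOREMS ONLY; count-neutral helper (`--supports stmt-HodgeConjecture-24833 --as helper`).  Exactly the theorems of the
original ★ file whose statements bind `Ch1.characterLocallyIntegrable` ∕ `normalizedCharacter_locallyBounded`, copied with the binder TYPE replaced by hHC₃ ∕ hHCB₃
(★ `K2E3CharLettersLeThreeDefs`), the rank∕non-split arguments supplied at each application (`2 ≤ N`, `N ≤ 3` by `norm_num`; the organ's `∀ w ∣ v, conj • w = w`), an added `hns`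
binder where the original head was place-agnostic, and calls into other cone files re-pointed to their twins; every other lemma of the original is used BY QUALIFIED NAME.
No new mathematics.  The original ★ declarations are untouched.

HONEST LABEL: HC_CM is proved only modulo the 7 printed citations (2 remaining named inputs: hLiu418 = `stmt-HodgeConjecture-24832`, h413 = `stmt-HodgeConjecture-24833`) until rung 0
closes; count-neutral; CONDITIONAL on the narrowed letters (stated, not assumed).

## References
* [Rogawski1990] J. D. Rogawski, *Automorphic Representations of Unitary Groups in Three Variables* (1990), §1.6 p. 5; §4.9 p. 54; §12.5–12.7.
* [HarishChandra1999AdmissibleDistributions] Harish-Chandra, *Admissible Invariant Distributions on Reductive p-adic Groups*, ULS 16 (1999), Thm. 16.3.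
-/

set_option autoImplicit false
-- the mandated namespace has the single-problem summit's repeated segment (`HodgeConjecture.HodgeConjecture`)
set_option linter.dupNamespace false

noncomputable section

open NumberField IsDedekindDomain MeasureTheory Filter Topology
open scoped Matrix MatrixGroups NNReal ENNReal
open Literature.NumberTheory.Rogawski1990 Literature.NumberTheory.Rogawski1990.Ch12Sec5
open Literature.NumberTheory.Automorphic Literature.NumberTheory.Automorphic.UnitaryGroup
open Literature.NumberTheory.GaloisRepresentations

open Summit.HodgeConjecture.HodgeConjecture.Cruxes.H413.K2E3CharLettersLeThreeDefs

namespace Summit.HodgeConjecture.HodgeConjecture.Cruxes.H413.K2E3KazhdanL2OrthonormalNotWildLeThree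

open Summit.HodgeConjecture.HodgeConjecture.Cruxes.H413 Summit.HodgeConjecture.HodgeConjecture.Cruxes.H413.F0P3cStCharTSTorusDefs

variable (L : Type) [Field L] [NumberField L] [IsCMField L] (v : HeightOneSpectrum (𝓞 ↥(maximalRealSubfield L)))

/-! ## §1 `⟨χ_π, χ_{π′}⟩_e = δ_{π,π′}` at a NOT-WILD place in junction letters — ★ `K2E3KazhdanL2OrthonormalNotWild.innerG_char_eq_ite_of_isL2_of_not_wild` (no `hHCB` binder) is REUSED BY QUALIFIED NAME -/

/-! ## §0 ★ PCT-OUT's five letters from the socket's Cartan ∕ `D_G` pins and Harish-Chandra's boundedness (★ J15's recipe; NO place token) -/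

set_option maxHeartbeats 1600000 in
set_option synthInstance.maxHeartbeats 400000 in
-- instance-term unification on the CM local carriers (class of ★ J15)
/-- **★ PCT-OUT's LETTERS AT THE SOCKET'S DATUM** — the Weyl integration formula, (C1) `EllCartanSubset`, (C2) `EllCartanAE`, (C3) `NonEllCartanAE` and (L2D∀)
`L2CharOnTorusAll` — DERIVED from the socket's own pins exactly as ★ «DATUM-JUNCTION v15» does: `hWIF` ⟸ ★ `weylIntegrationFormula_of_datumPins` (the
`M`-representative `M = Z(m₀)` by ★ `exists_isRegularElt_centralizer_eq_cmTorus`, the compact-Cartan tube Jacobians by ★ `tubeJacobianSocket_compactCartan`) over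
`hAll hcart hcovA hncA hcptA hHaar hHaarG hinvT hcoreT eDG`; (C1) ⟸ `hAll`; (C2) ⟸ ★ `ellCartanAE_of_compact_centralizers` + ★ `cartanNull_of_rootKernels` over `hE hcart hHaarG hker`;
(C3) ⟸ ★ `nonEllCartanAE_of_split` over `hC05 hE hAll hHaar`; (L2D∀) ⟸ ★ `l2CharOnTorusAll_of_hcBounded` over `hchar hcart hfinG eDG` AND the named input
`hHCB : normalizedCharacter_locallyBoundedLeThree` [HarishChandra1999 Thm. 16.3] — the ONE letter that is not among the socket's 54 pins (tier-0 stub 2 `stub_charLocBdd` of the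
same line).  Place-token free (every non-split `v`): it is what a WILD closer of row #15 also starts from.  Binder texts = the socket's pins VERBATIM.
[cite: Rogawski1990, §12.5 pp. 182–184] [cite: HarishChandra1970, Lemma 22; Lemma 42] [cite: HarishChandra1999, Thm. 16.3] -/
theorem pctOutLetters_of_pins
    (hns : ∀ w : PlacesOver L v, IsCMField.complexConj L • w.1 = w.1)
    [MeasurableSpace (Gqs L v)] [BorelSpace (Gqs L v)]
    [∀ γ : Gqs L v, MeasurableSpace (Gqs L v ⧸ Subgroup.centralizer ({γ} : Set (Gqs L v)))] [∀ γ : Gqs L v, BorelSpace (Gqs L v ⧸ Subgroup.centralizer ({γ} : Set (Gqs L v)))]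
    [MeasurableSpace (Gqs L v ⧸ Subgroup.center (Gqs L v))]
    {H : Type} [Group H] [TopologicalSpace H] [IsTopologicalGroup H] [MeasurableSpace H]
    (νQv : Measure (Gqs L v)) [νQv.IsHaarMeasure] [νQv.IsMulRightInvariant] (mQv : OrbitalMeasureFamily (Gqs L v))
    (hcanQ : mQv.IsCanonical (fun γ => IsRegularElt (γ.val : GL (Fin 3) (UnitaryGroup.LocalRing L v))) νQv)
    (𝔇 : EllipticData (Gqs L v) H)
    (hC01 : 𝔇.μG = νQv) (hC04 : 𝔇.orb = mQv)
    (hC05 : ∀ γ : Gqs L v, γ ∈ 𝔇.regG ↔ IsRegularElt (γ.val : GL (Fin 3) (UnitaryGroup.LocalRing L v)))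
    (hE : ∀ γ : Gqs L v, γ ∈ 𝔇.ellG ↔ IsRegularElt (γ.val : GL (Fin 3) (UnitaryGroup.LocalRing L v)) ∧ γ ∉ hyperbolicSet L v)
    (hchar : ∀ π : IrrClass (Gqs L v), Measurable (𝔇.char π) ∧ LocallyIntegrable (𝔇.char π) 𝔇.μG ∧
      (∀ x ∈ 𝔇.regG, ∀ᶠ y in 𝓝 x, 𝔇.char π y = 𝔇.char π x) ∧
      ∀ φ : Gqs L v → ℂ, IsLocSmooth φ → π.smoothTrace 𝔇.μG φ = ∫ x, φ x * 𝔇.char π x ∂𝔇.μG)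
    (hAll : ∀ T : Subgroup (Gqs L v), T ∈ 𝔇.cartanAll ↔ T = (cmBorelTriple L 3 v).M ∨ T ∈ 𝔇.cartanG)
    (hHaar : (𝔇.μT (cmBorelTriple L 3 v).M).IsHaarMeasure)
    (hcart : ∀ T ∈ 𝔇.cartanG, IsCompact (T : Set (Gqs L v)) ∧ ∃ γ₀ : Gqs L v, IsRegularElt (γ₀.val : GL (Fin 3) (UnitaryGroup.LocalRing L v)) ∧ T = Subgroup.centralizer ({γ₀} : Set (Gqs L v)))
    (hHaarG : ∀ T ∈ 𝔇.cartanG, (𝔇.μT T).IsHaarMeasure)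
    (hfinG : ∀ T ∈ 𝔇.cartanG, IsFiniteMeasure (𝔇.μT T))
    (hker : ∀ T ∈ 𝔇.cartanG, ∃ s : Finset (Subgroup ↥T), (∀ K ∈ s, IsClosed (K : Set ↥T) ∧ ¬ IsOpen (K : Set ↥T)) ∧ ∀ t : ↥T, ¬ IsRegularElt ((t : Gqs L v).val : GL (Fin 3) (UnitaryGroup.LocalRing L v)) → ∃ K ∈ s, t ∈ K)
    (eDG : ∀ g : Gqs L v, 𝔇.DG g = ((NNReal.sqrt (NNReal.sqrt ((∏ w : PlacesOver L v, IsNonarchimedeanLocalField.normAbs (w.1.adicCompletion L) (((g.val : GL (Fin 3) (UnitaryGroup.LocalRing L v)).val.charpoly.discr) w)) * ((∏ w : PlacesOver L v, IsNonarchimedeanLocalField.normAbs (w.1.adicCompletion L) (((g.val : GL (Fin 3) (UnitaryGroup.LocalRing L v)).val.det) w)) ^ 2)⁻¹)) : NNReal) : ℝ))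
    (hcovA : ∀ γ : Gqs L v, IsRegularElt (γ.val : GL (Fin 3) (UnitaryGroup.LocalRing L v)) → ∃ T' ∈ 𝔇.cartanAll, ∃ x : Gqs L v, ∀ g : Gqs L v, g ∈ Subgroup.centralizer ({γ} : Set (Gqs L v)) ↔ x⁻¹ * g * x ∈ T')
    (hncA : ∀ T' ∈ 𝔇.cartanAll, ∀ T'' ∈ 𝔇.cartanAll, T' ≠ T'' → ∀ y : Gqs L v, ¬ ∀ h : Gqs L v, h ∈ T'' ↔ y⁻¹ * h * y ∈ T')
    (hcptA : ∀ T' ∈ 𝔇.cartanAll, T' ≠ (cmBorelTriple L 3 v).M → IsCompact (T' : Set (Gqs L v)))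
    (hinvT : ∀ T' ∈ 𝔇.cartanAll, (𝔇.μT T').IsInvInvariant)
    (hcoreT : ∀ T' ∈ 𝔇.cartanAll, 𝔇.μT T' (compactCore ↥T') = 1)
    -- Harish-Chandra's local boundedness of `|D_G|^{1∕2} χ_π` — NOT a pin of the socket (tier-0 stub 2 `stub_charLocBdd`)
    (hHCB : normalizedCharacter_locallyBoundedLeThree) :
    𝔇.WeylIntegrationFormula ∧ 𝔇.EllCartanSubset ∧ 𝔇.EllCartanAE ∧ 𝔇.NonEllCartanAE ∧ 𝔇.L2CharOnTorusAll := by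
  -- ★ DG-FIELD: the `D_G` clauses from the closed formula `eDG`
  have hDGm : Measurable 𝔇.DG := F0P3cStCharTSDGField.measurable_DG L v 𝔇 eDG
  have hDG := F0P3cStCharTSDGField.DG_eq_zero_or_le L v 𝔇 eDG
  -- ★ WIF-AT-THE-DATUM: the Weyl integration formula from the Cartan pins (the `M`-representative ★ CartanReps, compact-Cartan tube Jacobians ★ JAC-ELL)
  have hShapeA : ∀ T' ∈ 𝔇.cartanAll, ∃ γ₀ : Gqs L v, IsRegularElt (γ₀.val : GL (Fin 3) (UnitaryGroup.LocalRing L v)) ∧ T' = Subgroup.centralizer ({γ₀} : Set (Gqs L v)) :=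
    fun T' hT' => by
    rcases (hAll T').1 hT' with h | h
    · subst h; obtain ⟨m₀, -, hreg, hZ⟩ := F0P3cStCharTSCartanReps.exists_isRegularElt_centralizer_eq_cmTorus L v hns; exact ⟨m₀, hreg, hZ.symm⟩
    · exact (hcart T' h).2
  have hHaarT : ∀ T' ∈ 𝔇.cartanAll, (𝔇.μT T').IsHaarMeasure := fun T' hT' => by
    rcases (hAll T').1 hT' with h | h
    · subst h; exact hHaar
    · exact hHaarG T' h
  have hWIF : 𝔇.WeylIntegrationFormula :=
    F0P3cStCharTSWeylDatumPinsWIF.weylIntegrationFormula_of_datumPins L v hns νQv mQv 𝔇 hC01 hC04 hcanQ hC05 hShapeA hcovA hncA hcptA hHaarT hinvT hcoreT eDG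
      (F0P3cStCharTSJacCartanTerminus.tubeJacobianSocket_compactCartan L v hns νQv)
  -- (C1) (C2) (C3) exactly as ★ J15
  have hC2cert : 𝔇.EllCartanAE :=
    F0P3cStCharTSCartanFields.ellCartanAE_of_compact_centralizers L v 𝔇 hE hcart
      (F0P3cStCharTSCartanNull.cartanNull_of_rootKernels L v 𝔇 hHaarG (fun T hT => (hcart T hT).1) hker)
  have hC1cert : 𝔇.EllCartanSubset := fun T hT => (hAll T).2 (Or.inr hT)
  have hC3cert : 𝔇.NonEllCartanAE :=
    F0P3cStCharTSCartanFields.nonEllCartanAE_of_split L v 𝔇 hC05 hE (fun T hT hTn => ((hAll T).1 hT).resolve_right hTn) hHaar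
  -- (L2D∀) from Harish-Chandra's boundedness `hHCB`
  have hL2allcert : 𝔇.L2CharOnTorusAll :=
    K2E3L2dOfHcbLeThree.l2CharOnTorusAll_of_hcBounded L v hHCB hns νQv 𝔇 hC01 hC05 hchar hDGm (fun T hT => (hcart T hT).1) hfinG hDG
  exact ⟨hWIF, hC1cert, hC2cert, hC3cert, hL2allcert⟩

/-! ## §2 §1 in the socket's pins: ★ PCT-OUT's letters discharged by §0 -/

set_option maxHeartbeats 1600000 in
set_option synthInstance.maxHeartbeats 400000 in
-- instance-term unification on the CM local carriers (class of ★ J15); `if` read classically, as in the socket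
open scoped Classical in
/-- **[K] THEOREM K ON `L²` PAIRS AT A NOT-WILD PLACE, socket pins.**  §1 with ★ PCT-OUT's five letters DERIVED: the Weyl integration formula from the socket's Cartan pins
(★ `weylIntegrationFormula_of_datumPins`, the representative `M = Z(m₀)` by ★ `exists_isRegularElt_centralizer_eq_cmTorus`, the compact-Cartan tube Jacobians by ★
`tubeJacobianSocket_compactCartan`), (C1) from `hAll`, (C2) by ★ `ellCartanAE_of_compact_centralizers` + ★ `cartanNull_of_rootKernels`, (C3) by ★ `nonEllCartanAE_of_split`,
and (L2D∀) by ★ `l2CharOnTorusAll_of_hcBounded` from `D_G`'s closed formula (`eDG`) AND the named input `hHCB : normalizedCharacter_locallyBoundedLeThree` [HarishChandra1999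
Thm. 16.3] — the only letter here that is not one of the socket's 54 pins (tier-0 stub 2 of the same line).  Binder texts = the socket's pins VERBATIM.
[cite: Rogawski1990, §12.6 Prop. 12.6.1 (a) p. 188; §12.5 p. 182] [cite: Kazhdan1986CuspidalGeometry, Thm. K] [cite: HarishChandra1999, Thm. 16.3] -/
theorem innerG_char_eq_ite_of_isL2_of_not_wild_of_pins
    (hns : ∀ w : PlacesOver L v, IsCMField.complexConj L • w.1 = w.1) (hv : Algebra.IsUnramifiedIn (𝓞 L) v.asIdeal ∨ Valued.v (2 : v.adicCompletion ↥(maximalRealSubfield L)) = 1)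
    [MeasurableSpace (Gqs L v)] [BorelSpace (Gqs L v)]
    [∀ γ : Gqs L v, MeasurableSpace (Gqs L v ⧸ Subgroup.centralizer ({γ} : Set (Gqs L v)))] [∀ γ : Gqs L v, BorelSpace (Gqs L v ⧸ Subgroup.centralizer ({γ} : Set (Gqs L v)))]
    [MeasurableSpace (Gqs L v ⧸ Subgroup.center (Gqs L v))] [BorelSpace (Gqs L v ⧸ Subgroup.center (Gqs L v))]
    {H : Type} [Group H] [TopologicalSpace H] [IsTopologicalGroup H] [MeasurableSpace H]
    (νQv : Measure (Gqs L v)) [νQv.IsHaarMeasure] [νQv.IsMulRightInvariant] (mQv : OrbitalMeasureFamily (Gqs L v))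
    (hcanQ : mQv.IsCanonical (fun γ => IsRegularElt (γ.val : GL (Fin 3) (UnitaryGroup.LocalRing L v))) νQv)
    (μZ : Measure (Gqs L v ⧸ Subgroup.center (Gqs L v))) [μZ.IsHaarMeasure]
    (𝔇 : EllipticData (Gqs L v) H)
    (hC01 : 𝔇.μG = νQv) (hC03 : 𝔇.μGZ = μZ) (hC04 : 𝔇.orb = mQv)
    (hC05 : ∀ γ : Gqs L v, γ ∈ 𝔇.regG ↔ IsRegularElt (γ.val : GL (Fin 3) (UnitaryGroup.LocalRing L v)))
    (hE : ∀ γ : Gqs L v, γ ∈ 𝔇.ellG ↔ IsRegularElt (γ.val : GL (Fin 3) (UnitaryGroup.LocalRing L v)) ∧ γ ∉ hyperbolicSet L v)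
    (hchar : ∀ π : IrrClass (Gqs L v), Measurable (𝔇.char π) ∧ LocallyIntegrable (𝔇.char π) 𝔇.μG ∧
      (∀ x ∈ 𝔇.regG, ∀ᶠ y in 𝓝 x, 𝔇.char π y = 𝔇.char π x) ∧
      ∀ φ : Gqs L v → ℂ, IsLocSmooth φ → π.smoothTrace 𝔇.μG φ = ∫ x, φ x * 𝔇.char π x ∂𝔇.μG)
    (hAll : ∀ T : Subgroup (Gqs L v), T ∈ 𝔇.cartanAll ↔ T = (cmBorelTriple L 3 v).M ∨ T ∈ 𝔇.cartanG)
    (hHaar : (𝔇.μT (cmBorelTriple L 3 v).M).IsHaarMeasure)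
    (hcart : ∀ T ∈ 𝔇.cartanG, IsCompact (T : Set (Gqs L v)) ∧ ∃ γ₀ : Gqs L v, IsRegularElt (γ₀.val : GL (Fin 3) (UnitaryGroup.LocalRing L v)) ∧ T = Subgroup.centralizer ({γ₀} : Set (Gqs L v)))
    (hHaarG : ∀ T ∈ 𝔇.cartanG, (𝔇.μT T).IsHaarMeasure)
    (hfinG : ∀ T ∈ 𝔇.cartanG, IsFiniteMeasure (𝔇.μT T))
    (hker : ∀ T ∈ 𝔇.cartanG, ∃ s : Finset (Subgroup ↥T), (∀ K ∈ s, IsClosed (K : Set ↥T) ∧ ¬ IsOpen (K : Set ↥T)) ∧ ∀ t : ↥T, ¬ IsRegularElt ((t : Gqs L v).val : GL (Fin 3) (UnitaryGroup.LocalRing L v)) → ∃ K ∈ s, t ∈ K)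
    (eDG : ∀ g : Gqs L v, 𝔇.DG g = ((NNReal.sqrt (NNReal.sqrt ((∏ w : PlacesOver L v, IsNonarchimedeanLocalField.normAbs (w.1.adicCompletion L) (((g.val : GL (Fin 3) (UnitaryGroup.LocalRing L v)).val.charpoly.discr) w)) * ((∏ w : PlacesOver L v, IsNonarchimedeanLocalField.normAbs (w.1.adicCompletion L) (((g.val : GL (Fin 3) (UnitaryGroup.LocalRing L v)).val.det) w)) ^ 2)⁻¹)) : NNReal) : ℝ))
    (hcovA : ∀ γ : Gqs L v, IsRegularElt (γ.val : GL (Fin 3) (UnitaryGroup.LocalRing L v)) → ∃ T' ∈ 𝔇.cartanAll, ∃ x : Gqs L v, ∀ g : Gqs L v, g ∈ Subgroup.centralizer ({γ} : Set (Gqs L v)) ↔ x⁻¹ * g * x ∈ T')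
    (hncA : ∀ T' ∈ 𝔇.cartanAll, ∀ T'' ∈ 𝔇.cartanAll, T' ≠ T'' → ∀ y : Gqs L v, ¬ ∀ h : Gqs L v, h ∈ T'' ↔ y⁻¹ * h * y ∈ T')
    (hcptA : ∀ T' ∈ 𝔇.cartanAll, T' ≠ (cmBorelTriple L 3 v).M → IsCompact (T' : Set (Gqs L v)))
    (hinvT : ∀ T' ∈ 𝔇.cartanAll, (𝔇.μT T').IsInvInvariant)
    (hcoreT : ∀ T' ∈ 𝔇.cartanAll, 𝔇.μT T' (compactCore ↥T') = 1)
    -- Harish-Chandra's local boundedness of `|D_G|^{1∕2} χ_π` — NOT a pin of the socket (tier-0 stub 2 `stub_charLocBdd`)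
    (hHCB : normalizedCharacter_locallyBoundedLeThree) :
    ∀ π π' : IrrClass (Gqs L v), 𝔇.IsL2 π → 𝔇.IsL2 π' → 𝔇.innerG (𝔇.char π) (𝔇.char π') = if π = π' then 1 else 0 := by
  obtain ⟨hWIF, hC1, hC2, hC3, hL2⟩ :=
    pctOutLetters_of_pins L v hns νQv mQv hcanQ 𝔇 hC01 hC04 hC05 hE hchar hAll hHaar hcart hHaarG hfinG hker eDG hcovA hncA hcptA hinvT hcoreT hHCB
  exact K2E3KazhdanL2OrthonormalNotWild.innerG_char_eq_ite_of_isL2_of_not_wild L v hns hv νQv mQv hcanQ 𝔇 hC01 hC04 hC05 hE hchar μZ hC03 hWIF hC1 hC2 hC3 hL2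

end Summit.HodgeConjecture.HodgeConjecture.Cruxes.H413.K2E3KazhdanL2OrthonormalNotWildLeThree

end
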